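/-
COR-CM (cell pub-hodgecm2, stage 2 of the Hodge ladder) — Δ2 bridge, (c)+(d) closure at ι₁ after the coordinator's ruling «WORLD = C»
(pub-hodgecm2/INBOX 2026-08-23, item (4)), package P1 step W2′-(1): Liu's §4.2 standing datum `C` over the UNTWISTED Prop-C.5 datum
`Model.honestP5IdOf h` (`HComp/HonestP5Id.lean`), as a total term.  Seat prover-pub-hodgecm2-rekey-l0-instlevel-a-g1-0.
DEFINITIONS (by formula) + theorems; the named fact `h : exists_recordSystem` is a parameter of the definitions exactly as in
`HComp/Sec42DataOf.lean`; nothing asserted; nothing in the tree edited or restated.  FRAMING: HC_CM is NOT proved.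
-/
import Summits.HodgeConjecture.CorCM.B01.Transposition.HComp.HonestP5Id
import Summits.HodgeConjecture.CorCM.B01.Transposition.HComp.Sec42DataOf
import HarnessLib

/-!
# TEAM hComp, package P1 step W2′-(1): `Model.sec42DataIdOf` — the §4.2 carrier `C` over the UNTWISTED datum `honestP5IdOf h`

`HComp/Sec42DataOf.lean` (prove-5 ∕ pin-1 ∕ b25) builds `sec42DataOf h iso : ∀ F ι₁ V Φ, Sec42Data (honestP5Of h F ι₁ V Φ) (iso …)` over the
TWISTED datum (`X_K := M_K ⊗_{F,c} F`).  This file repeats the construction over the untwisted datum of `HComp/HonestP5Id.lean`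
(`X_K := M_K`), every step SIMPLER (no base change along `c`):
* §1 (`4 ≤ [F:ℚ]`, Compact Case): the untwisted system `honestSystemIdOf h V Φ := honestSystemId V (K3 V) (recordFunctorOf h V)` is
  smooth of relative dimension `2` and projective level by level (the record's (F1) fields DIRECTLY), Def. C.8 = `compactifiedIdOf`
  (`CompactifiedSystem.ofProjective`), «projective iff Compact Case» both true, and
  `sec42DataIdOfFourLe h V Φ h4 iso : Sec42Data (honestP5IdOf h F ι₁ V Φ) iso := Sec42Data.ofAlbanese …` with `A_K := Alb_{M_K}` chosen
  from `Albanese.nonempty_of_numberField` — `_S ∕ _cpt ∕ _X` by `rfl` (`X_K = M_K` ON THE NOSE);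
* §2 (`[F⁺:ℚ] = 1`, read by no display): the untwisted punctured inhabitant (`X_K := ℙ²_F`, `j :=` pin-1's open immersion
  `ℙ² ∖ pt ↪ ℙ²`, no base change) — `nonempty_sec42Data_puncturedId_albFree`;
* §3 the TOTAL term `sec42DataIdOf h iso : ∀ F ι₁ V Φ, Sec42Data (honestP5IdOf h F ι₁ V Φ) (iso F ι₁ V Φ)` (`dif` on `4 ≤ [F:ℚ]`),
  `sec42DataIdOf_eq_of_four_le ∕ _S ∕ _eq_of_six_le`.
Sequel (W2′-(2)…): Hecke translates, `ComponentAlbanese` at instance `ι₁` over this carrier (the cofan along `ι₁` is `hUnif_holds_id`).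
CONDITIONAL on `h` only; HC_CM is NOT proved; «Δ2 BRIDGE CLOSED» is NOT claimed.
-/

noncomputable section

open CategoryTheory CategoryTheory.Limits AlgebraicGeometry NumberField
open Literature.AlgebraicGeometry.Motives
open Literature.AlgebraicGeometry.ShimuraVarieties.UnitaryCanonicalModel
open Literature.NumberTheory.Automorphic
open Literature.NumberTheory.Automorphic.Liu2021
open Literature.NumberTheory.Automorphic.Liu2021.AppendixC
open Summit.HodgeConjecture.CorCM.HComp
open Summit.HodgeConjecture.CorCM.HComp.PuncturedPlane

namespace Summit.HodgeConjecture.CorCM.Model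

open HComp

/-! ## §1  `4 ≤ [F:ℚ]`: the untwisted system is smooth projective; Def. C.8; the explicit `Sec42Data` -/

section FourLe

/- `h : exists_recordSystem`, `V`, `Φ` are explicit per-declaration binders below (no section `variable` carrying a named Prop). -/
variable {F : CMField} {ι₁ : F →+* ℂ}

/-- **Prop. C.5 CONSTRUCTED on the untwisted total datum**: `honestSystemId` at `M := recordFunctorOf h V`, threshold `K_f(3)`,
`Sh(𝕍)_K := M_K`. [cite: Liu2021, Prop. C.5 l. 4627–4633 and Def. C.6] -/
abbrev honestSystemIdOf (h : exists_recordSystem) (V : HermSpace3 F ι₁)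
    (Φ : Literature.AlgebraicGeometry.Motives.CMType F) :
    IncoherentShimuraSystem (honestP5IdOf h F ι₁ V Φ) :=
  honestSystemId V (K3 V) (recordFunctorOf h V)

/-- `Sh(𝕍)_K = M_K` of the untwisted system is smooth over `F` of relative dimension `n − 1 = 2` for `4 ≤ [F:ℚ]` (the record's (F1) field
`RecordSystem.smooth`, no base change). [cite: Liu2021, App. C l. 4656] [cite: Deligne1979ShimuraVarieties, 2.2.5 and Cor. 2.7.21] -/
theorem smooth_honestSystemIdOf_Sh (h : exists_recordSystem) (V : HermSpace3 F ι₁)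
    (Φ : Literature.AlgebraicGeometry.Motives.CMType F)
    (h4 : 4 ≤ Module.finrank ℚ F) (K : C5.SmallLevel (honestSystemIdOf h V Φ).K₀) :
    SmoothOfRelativeDimension ((honestP5IdOf h F ι₁ V Φ).n - 1) ((honestSystemIdOf h V Φ).Sh𝕍.obj K).hom :=
  smooth_recordFunctorOf_obj h V h4 K

/-- `Sh(𝕍)_K = M_K` of the untwisted system is projective over `F` for `4 ≤ [F:ℚ]` (the record's (F1) field `RecordSystem.projective`).
[cite: Liu2021, App. C l. 4656] [cite: Deligne1979ShimuraVarieties, 2.2.5 and Cor. 2.7.21] -/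
theorem projective_honestSystemIdOf_Sh (h : exists_recordSystem) (V : HermSpace3 F ι₁)
    (Φ : Literature.AlgebraicGeometry.Motives.CMType F)
    (h4 : 4 ≤ Module.finrank ℚ F) (K : C5.SmallLevel (honestSystemIdOf h V Φ).K₀) :
    IsProjectiveOver ((honestSystemIdOf h V Φ).Sh𝕍.obj K) :=
  projective_recordFunctorOf_obj h V h4 K

/-- **Def. C.8 on the untwisted total datum in the Compact Case** (`4 ≤ [F:ℚ]`): `\overline{Sh} := S̃h := X := Sh(𝕍) = M`, identity
comparison maps, empty boundary (b11's `CompactifiedSystem.ofProjective`). [cite: Liu2021, App. C l. 4656 and Def. C.8] -/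
def compactifiedIdOf (h : exists_recordSystem) (V : HermSpace3 F ι₁)
    (Φ : Literature.AlgebraicGeometry.Motives.CMType F)
    (h4 : 4 ≤ Module.finrank ℚ F) : CompactifiedSystem (honestSystemIdOf h V Φ) :=
  CompactifiedSystem.ofProjective (honestSystemIdOf h V Φ) (smooth_honestSystemIdOf_Sh h V Φ h4)
    (projective_honestSystemIdOf_Sh h V Φ h4)

/-- «It is projective if and only if we are in the Compact Case» ([Liu2021] §4.2 l. 2060) for the untwisted system at `4 ≤ [F:ℚ]`:
both sides hold. [cite: Liu2021, §4.2 l. 2053–2060] -/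
theorem isProjectiveOver_honestSystemIdOf_Sh_iff (h : exists_recordSystem) (V : HermSpace3 F ι₁)
    (Φ : Literature.AlgebraicGeometry.Motives.CMType F)
    (h4 : 4 ≤ Module.finrank ℚ F) (iso : ℕ → Prop)
    (K : C5.SmallLevel (honestSystemIdOf h V Φ).K₀) :
    IsProjectiveOver ((honestSystemIdOf h V Φ).Sh𝕍.obj K) ↔
      ¬ (Module.finrank ℚ (maximalRealSubfield F) = 1 ∧
        (3 ≤ (honestP5IdOf h F ι₁ V Φ).n ∨ ((honestP5IdOf h F ι₁ V Φ).n = 2 ∧ ∀ p : ℕ, p.Prime → iso p))) :=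
  ⟨fun _ hh => finrank_maximalRealSubfield_ne_one h4 hh.1, fun _ => projective_honestSystemIdOf_Sh h V Φ h4 K⟩

/-- **Liu's §4.2 standing datum over the UNTWISTED honest datum, EXPLICIT, for `4 ≤ [F:ℚ]`** (Compact Case): Prop. C.5's system is
`honestSystemIdOf h V Φ` (`Sh(𝕍)_K = X_K = M_K`), «projective iff Compact Case» holds with both sides true, Def. C.8 is `compactifiedIdOf`,
the Albanese data `A_K := Alb_{M_K}` of the proper smooth `M_K` are chosen from `Albanese.nonempty_of_numberField` ([Liu2021] §2.1
Prop. 2.2, PROVED for smooth projective schemes over number fields), and `∇u`, `Alb_u` are `Sec42Data.ofAlbanese`'s.  CONDITIONAL on `h`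
only; HC_CM is NOT proved. [cite: Liu2021, §4.2 l. 2053–2074, §2.1 Prop. 2.2 l. 1190–1200, App. C l. 4656 and Def. C.8]
[cite: Deligne1979ShimuraVarieties, 2.2.5 and Cor. 2.7.21] -/
def sec42DataIdOfFourLe (h : exists_recordSystem) (V : HermSpace3 F ι₁)
    (Φ : Literature.AlgebraicGeometry.Motives.CMType F)
    (h4 : 4 ≤ Module.finrank ℚ F) (iso : ℕ → Prop) :
    Sec42Data (honestP5IdOf h F ι₁ V Φ) iso :=
  Sec42Data.ofAlbanese (Nat.le_of_ble_eq_true rfl) (honestSystemIdOf h V Φ)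
    (isProjectiveOver_honestSystemIdOf_Sh_iff h V Φ h4 iso) (compactifiedIdOf h V Φ h4) fun K =>
      haveI := (compactifiedIdOf h V Φ h4).smooth_X K
      Classical.choice
        (Albanese.nonempty_of_numberField (d := (honestP5IdOf h F ι₁ V Φ).n - 1) ((compactifiedIdOf h V Φ h4).X.obj K)
          ((compactifiedIdOf h V Φ h4).projective_X K))

/-- Its Prop.-C.5 system IS `honestSystemIdOf h V Φ` (by `rfl`). [cite: Liu2021, Prop. C.5 l. 4627–4633] -/
theorem sec42DataIdOfFourLe_S (h : exists_recordSystem) (V : HermSpace3 F ι₁)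
    (Φ : Literature.AlgebraicGeometry.Motives.CMType F)
    (h4 : 4 ≤ Module.finrank ℚ F) (iso : ℕ → Prop) :
    (sec42DataIdOfFourLe h V Φ h4 iso).S = honestSystemIdOf h V Φ := rfl

/-- Its compactified system IS `compactifiedIdOf h V Φ h4` (by `rfl`). [cite: Liu2021, App. C l. 4656 and Def. C.8] -/
theorem sec42DataIdOfFourLe_cpt (h : exists_recordSystem) (V : HermSpace3 F ι₁)
    (Φ : Literature.AlgebraicGeometry.Motives.CMType F)
    (h4 : 4 ≤ Module.finrank ℚ F) (iso : ℕ → Prop) :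
    (sec42DataIdOfFourLe h V Φ h4 iso).cpt = compactifiedIdOf h V Φ h4 := rfl

/-- Hence its `X_K` is `M_K` ON THE NOSE (by `rfl`) — the canonical model itself, no twist. [cite: Liu2021, §4.2 l. 2062 and App. C l. 4656] -/
theorem sec42DataIdOfFourLe_X (h : exists_recordSystem) (V : HermSpace3 F ι₁)
    (Φ : Literature.AlgebraicGeometry.Motives.CMType F)
    (h4 : 4 ≤ Module.finrank ℚ F) (iso : ℕ → Prop) (K : C5.SmallLevel (K3 V)) :
    (sec42DataIdOfFourLe h V Φ h4 iso).X K = (recordFunctorOf h V).obj K := rfl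

end FourLe

/-! ## §2  `[F⁺:ℚ] = 1`: the untwisted punctured inhabitant (read by no display) -/

section Punctured

variable {F : CMField} {ι₁ : F →+* ℂ} (V : HermSpace3 F ι₁) (K₀ : C5.OpenCompactSubgroup ↥V.adelicFin)

/-- `X_K = ℙ²_F ∖ pt` of the untwisted constant punctured system is NOT projective over `F`. [cite: Liu2021, §4.2 l. 2060] -/
theorem not_isProjectiveOver_puncturedId_Sh (K : C5.SmallLevel K₀) :
    ¬ IsProjectiveOver ((honestSystemId V K₀ ((Functor.const _).obj (puncturedPlane F))).Sh𝕍.obj K) :=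
  not_isProjectiveOver_puncturedPlane F

/-- «projective iff Compact Case» ([Liu2021] §4.2 l. 2060) for the untwisted punctured system at `d = 1`, `n = 3`: both sides FALSE.
[cite: Liu2021, §4.2 l. 2053–2060] -/
theorem isProjectiveOver_puncturedId_Sh_iff (hd : Module.finrank ℚ (maximalRealSubfield F) = 1) (iso : ℕ → Prop)
    (K : C5.SmallLevel K₀) :
    IsProjectiveOver ((honestSystemId V K₀ ((Functor.const _).obj (puncturedPlane F))).Sh𝕍.obj K) ↔
      ¬ (Module.finrank ℚ (maximalRealSubfield F) = 1 ∧
        (3 ≤ (honestP5Id V K₀ ((Functor.const _).obj (puncturedPlane F))).n ∨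
          ((honestP5Id V K₀ ((Functor.const _).obj (puncturedPlane F))).n = 2 ∧ ∀ p : ℕ, p.Prime → iso p))) :=
  ⟨fun hK => absurd hK (not_isProjectiveOver_puncturedId_Sh V K₀ K), fun hK => absurd ⟨hd, Or.inl le_rfl⟩ hK⟩

/-- **The untwisted punctured-branch inhabitant WITHOUT `exists_albanese`** (`[F⁺:ℚ] = 1`): Def. C.8 AS TYPED with `X_K := ℙ²_F`,
`jBar = j :=` pin-1's open immersion `ℙ² ∖ pt ↪ ℙ²` (one boundary point), `blowDown := 𝟙`, no base change; closed by hcomp-abcm-1's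
`Sec42Data.nonempty` (Albanese data EXIST for smooth projective `X_K` over a number field).
[cite: Liu2021, §4.2 l. 2053–2072, §2.1 Prop. 2.2 l. 1190–1200, App. C l. 4656–4670, Def. C.8] -/
theorem nonempty_sec42Data_puncturedId_albFree (hd : Module.finrank ℚ (maximalRealSubfield F) = 1) (iso : ℕ → Prop) :
    Nonempty (Sec42Data (honestP5Id V K₀ ((Functor.const _).obj (puncturedPlane F))) iso) := by
  obtain ⟨ιU, hιU, hbd⟩ := exists_openImmersion_puncturedPlane F
  haveI := hιU
  let cpt : CompactifiedSystem (honestSystemId V K₀ ((Functor.const _).obj (puncturedPlane F))) :=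
    { ShBar := fun _ => projectiveSpace 2 (F : Type)
      jBar := fun _ => ιU
      isOpenImmersion_jBar := fun _ => hιU
      discrete_boundary := fun _ => @Subsingleton.discreteTopology _ _ hbd.coe_sort
      X := (Functor.const _).obj (projectiveSpace 2 (F : Type))
      blowDown := fun _ => 𝟙 _
      j := (Functor.const _).map ιU
      j_blowDown := fun _ => Category.comp_id _
      isOpenImmersion_j := fun _ => hιU
      isIso_j_of_isProper := fun _ hK => absurd hK (not_isProper_puncturedPlane F)
      smooth_Sh := fun _ => smooth_puncturedPlane F
      projective_Sh_of := fun hdn K => by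
        exfalso
        rcases hdn with h1 | h1
        · rw [hd] at h1
          exact lt_irrefl _ h1
        · have h3 : (honestP5Id V K₀ ((Functor.const (C5.SmallLevel K₀)).obj (puncturedPlane F))).n = 3 := rfl
          omega
      smooth_X := fun _ => smooth_projectiveSpace_two F
      projective_X := fun _ => isProjectiveOver_projectiveSpace_two F }
  exact Sec42Data.nonempty iso (Nat.le_of_ble_eq_true rfl)
    (honestSystemId V K₀ ((Functor.const _).obj (puncturedPlane F))) (isProjectiveOver_puncturedId_Sh_iff V K₀ hd iso) cpt

end Punctured

/-! ## §3  The total term `sec42DataIdOf` -/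

/-- **`Model.sec42DataIdOf h iso` — Liu's §4.2 carrier `C` over the UNTWISTED honest datum, as a TOTAL function of `(F, ι₁, V, Φ)`**:
`sec42DataIdOfFourLe` when `4 ≤ [F:ℚ]` (every face a display reads has `6 ≤ [F:ℚ]`), and the untwisted punctured-branch inhabitant
otherwise (`[F:ℚ] = 2`, read by no display).  CONDITIONAL on `h` only; HC_CM is NOT proved. [cite: Liu2021, §4.2 l. 2053–2074 and §2.1 Prop. 2.2]
[cite: Deligne1979ShimuraVarieties, 2.2.5 and Cor. 2.7.21] -/
def sec42DataIdOf (h : exists_recordSystem)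
    (iso : ∀ (F : CMField) (ι₁ : F →+* ℂ) (_ : HermSpace3 F ι₁) (_ : Literature.AlgebraicGeometry.Motives.CMType F), ℕ → Prop)
    (F : CMField) (ι₁ : F →+* ℂ) (V : HermSpace3 F ι₁) (Φ : Literature.AlgebraicGeometry.Motives.CMType F) :
    Sec42Data (honestP5IdOf h F ι₁ V Φ) (iso F ι₁ V Φ) :=
  if h4 : 4 ≤ Module.finrank ℚ F then sec42DataIdOfFourLe h V Φ h4 (iso F ι₁ V Φ)
  else Classical.choice (by
    show Nonempty (Sec42Data (honestP5Id V (K3 V) (recordFunctorOf h V)) (iso F ι₁ V Φ))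
    rw [recordFunctorOf_eq_punctured V h h4]
    exact nonempty_sec42Data_puncturedId_albFree V (K3 V) (finrank_maximalRealSubfield_eq_one h4) (iso F ι₁ V Φ))

/-- At every `F` with `4 ≤ [F:ℚ]` the total carrier IS the explicit one (`dif_pos`). [cite: Liu2021, §4.2 l. 2053–2074] -/
theorem sec42DataIdOf_eq_of_four_le (h : exists_recordSystem) {F : CMField} {ι₁ : F →+* ℂ} (V : HermSpace3 F ι₁)
    (Φ : Literature.AlgebraicGeometry.Motives.CMType F)
    (iso : ∀ (F : CMField) (ι₁ : F →+* ℂ) (_ : HermSpace3 F ι₁) (_ : Literature.AlgebraicGeometry.Motives.CMType F), ℕ → Prop)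
    (h4 : 4 ≤ Module.finrank ℚ F) :
    sec42DataIdOf h iso F ι₁ V Φ = sec42DataIdOfFourLe h V Φ h4 (iso F ι₁ V Φ) :=
  dif_pos h4

/-- … so its Prop.-C.5 system is the untwisted record system `honestSystemIdOf h V Φ`. [cite: Liu2021, Prop. C.5 l. 4627–4633] -/
theorem sec42DataIdOf_S (h : exists_recordSystem) {F : CMField} {ι₁ : F →+* ℂ} (V : HermSpace3 F ι₁)
    (Φ : Literature.AlgebraicGeometry.Motives.CMType F)
    (iso : ∀ (F : CMField) (ι₁ : F →+* ℂ) (_ : HermSpace3 F ι₁) (_ : Literature.AlgebraicGeometry.Motives.CMType F), ℕ → Prop)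
    (h4 : 4 ≤ Module.finrank ℚ F) :
    (sec42DataIdOf h iso F ι₁ V Φ).S = honestSystemIdOf h V Φ := by
  rw [sec42DataIdOf_eq_of_four_le h V Φ iso h4]
  rfl

/-- … and at every face the chain reads (`6 ≤ [F:ℚ]`). [cite: Liu2021, §4.2 l. 2053–2074] -/
theorem sec42DataIdOf_eq_of_six_le (h : exists_recordSystem) {F : CMField} {ι₁ : F →+* ℂ} (V : HermSpace3 F ι₁)
    (Φ : Literature.AlgebraicGeometry.Motives.CMType F)
    (iso : ∀ (F : CMField) (ι₁ : F →+* ℂ) (_ : HermSpace3 F ι₁) (_ : Literature.AlgebraicGeometry.Motives.CMType F), ℕ → Prop)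
    (h6 : 6 ≤ Module.finrank ℚ F) :
    sec42DataIdOf h iso F ι₁ V Φ = sec42DataIdOfFourLe h V Φ (le_trans (by norm_num) h6) (iso F ι₁ V Φ) :=
  dif_pos _

end Summit.HodgeConjecture.CorCM.Model

end
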